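import Literature.NumberTheory.LFunctions.Zhang2022.MainTermFormKernel
import Literature.NumberTheory.LFunctions.Zhang2022.MainTermFormH1

/-!
# The kernel of the main-term form `𝔅` on `H¹` (kinked) profiles

Companion to `MainTermFormKernel` (kernel of `𝔅` on `C¹` profiles) and `MainTermFormH1`
(`𝔅 ≥ 0` on `H¹` profiles) — repair cell `pub-zhang`, autopsy of Y. Zhang, *Discrete mean estimates
and the Landau–Siegel zero*, arXiv:2211.02515 (2022) [Zhang2022LandauSiegel]. The cell's verdict on
that manuscript is NEGATIVE (the printed inequality (8.24) fails, `Zhang2022.not_ineq824`); this file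
makes no claim about its Theorems 1–2.

The glued main-term Hermitian form `𝔅` (`mainTermForm`, STRUCTURE.md (4.1) of the cell) is applied
by the cell to the manuscript's mollifier profiles, which are continuous and piecewise poly×exp in the
logarithmic variable, with KINKS at the gluing points: they are `H¹`, not `C¹`. `MainTermFormH1`
proves `𝔅 ≥ 0` on `H¹` (`mainTermForm_nonneg_of_isH1`); `MainTermFormKernel` proves, for `C¹`
profiles only, that the kernel of `𝔅` is exactly the span of the three approximate-functional-equation
directions `e^{−iπy}, e^{−2iπy}, e^{−3iπy}` (`mainTermForm_eq_zero_iff_afeSpan`). This file closes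
the remaining gap of the cell's theorem O15 on the class actually used:

* `mainTermForm_eq_zero_iff_afeSpan_of_isH1` — for every `H¹` profile `g` (marked weak derivative
  `g′`), `𝔅(g,g) = 0 ↔ ∃ a b c, g = a e^{−iπy} + b e^{−2iπy} + c e^{−3iπy}` on `[0,1]`; hence
  `𝔅(g,g) > 0` for every other `H¹` profile (`mainTermForm_pos_of_not_afeSpan_of_isH1`), and the
  kinked-profile entry point `mainTermForm_eq_zero_iff_afeSpan_of_hasDerivWithinAt_Ioi`.
* `sum_range_le_mainTermForm_of_isH1`, `tsum_le_mainTermForm_of_isH1` — **Bessel form of the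
  sum-of-squares identity on `H¹`**: `(8/π) ∑ₖ π⁴(k−1)k(k+1)(k+2)|c_k(R₁)|² ≤ 𝔅(g,g)`, where `R₁` is
  the reduced modulated primitive of `g` (`rsReduce_f_apply`; it depends on `g` only, not on `g′`) and
  `c_k` its quarter-wave sine coefficients; in particular each single mode is bounded by `𝔅(g,g)`
  (`coeffTerm_le_mainTermForm_of_isH1`), so `𝔅(g,g) = 0` kills every `c_k(R₁)`, `k ≥ 2`
  (`qwCoeff_rsReduce_eq_zero_of_isH1`).
* `IsH1OnUnitInterval.ae_eq_of_hasDerivAt` — the marked weak derivative of an `H¹` profile agrees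
  a.e. on `(0,1)` with the classical derivative wherever the latter exists on `(0,1)` (Lebesgue's
  differentiation theorem, `IntervalIntegrable.ae_hasDerivAt_integral`), and `mainTermForm_congr_ae` —
  `𝔅(g,g′)` depends only on `g|[0,1]` and on `g′` almost everywhere on `(0,1)`.

## Proof

(⇒) `MainTermFormH1`'s density argument, repackaged as `IsH1OnUnitInterval.exists_c1_approx`
(`C¹` profiles `Gₙ → g` uniformly on `[0,1]` with `𝔅(Gₙ,Gₙ) → 𝔅(g,g)`): the reduced modulated
primitives converge uniformly (`norm_rsReduce_f_sub_le`, `‖R₁(G) − R₁(g)‖_∞ ≤ 3‖G − g‖_∞`), so every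
quarter-wave coefficient converges (`tendsto_qwCoeff_rsReduce`), and the finite partial sums of
`MainTermFormPSD.mainTermForm_hasSum` for `Gₙ` pass to the limit (`le_of_tendsto_of_tendsto'`). With
`𝔅(g,g) = 0` all `c_k(R₁)`, `k ≥ 2`, vanish; `R₁` is continuous, so the completeness lemma
`eqOn_modes_of_qwCoeff_eq_zero` and the Laurent-polynomial algebra of `MainTermFormKernel` put `g` in
the span — the `C¹` hypothesis of `exists_eqOn_afeSpan_of_qwCoeff_eq_zero` is only used through the
continuity of `g` on `[0,1]` (`exists_eqOn_afeSpan_of_qwCoeff_eq_zero_of_continuousOn`).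
(⇐) On the span `g` is smooth; its marked weak derivative equals the classical one a.e.
(`IsH1OnUnitInterval.ae_eq_of_hasDerivAt`), so `𝔅(g,g′) = 𝔅(span, span′) = 0` by
`mainTermForm_congr_ae` and `MainTermFormKernel.mainTermForm_afeSpan`.

All declarations are elementary real analysis, tagged `[folklore]`; the STATEMENT (the form `𝔅`, its
kernel, and their role in the cell's refutation of every redesign of the manuscript's §8 comparison at
main order, REPAIR-CENSUS V8b) is the repair cell's (pub-zhang STRUCTURE.md §§4–5, PROOF-O15.md).

NOT here: the EQUALITY `𝔅(g,g) = (8/π)∑ₖ w_k|c_k(R₁)|²` on `H¹` (only the Bessel inequality `≤` is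
proved; equality holds by an `H²`-Parseval argument for `R₁″` that is not formalised), and the spectral
gap `λ₄` of the cell's LAMBDA4-CERT (numerical certificate outside the kernel).
-/

noncomputable section

open MeasureTheory Set intervalIntegral Filter
open scoped Real ComplexConjugate Topology
open Literature.Analysis.Fourier

namespace Literature.NumberTheory.LFunctions.Zhang2022

variable {g g' : ℝ → ℂ}

/-! ### The reduced modulated primitive depends continuously (sup norm) on the profile -/

/-- The reduced modulated primitive `R₁` of `g` does not depend on the marked derivative `g′`.
[folklore] -/
theorem rsReduce_f_indep (g g₁' g₂' : ℝ → ℂ) :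
    (rsReduce (primitiveJet g g₁').modulate).f = (rsReduce (primitiveJet g g₂').modulate).f := rfl

/-- `|E(y)| = 1` for the demodulation phase. [folklore] -/
theorem norm_modPhase (y : ℝ) : ‖modPhase y‖ = 1 := by
  rw [modPhase, Complex.norm_exp_ofReal_mul_I]

/-- `|R*(y)| ≤ 2` for the radical direction `R* = cos(πy/2) − cos(3πy/2)`. [folklore] -/
theorem norm_rsF_le (y : ℝ) : ‖rsF y‖ ≤ 2 := by
  rw [rsF, Complex.norm_real, Real.norm_eq_abs]
  have h1 := Real.abs_cos_le_one (qwFreq 0 * y)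
  have h2 := Real.abs_cos_le_one (qwFreq 1 * y)
  calc |Real.cos (qwFreq 0 * y) - Real.cos (qwFreq 1 * y)|
      ≤ |Real.cos (qwFreq 0 * y)| + |Real.cos (qwFreq 1 * y)| := abs_sub _ _
    _ ≤ 2 := by linarith

/-- `R₁` is continuous on `[0,1]` as soon as `g` is. [folklore] -/
theorem continuousOn_rsReduce_f (hgc : ContinuousOn g (Icc 0 1)) :
    ContinuousOn (rsReduce (primitiveJet g g').modulate).f (Icc 0 1) := by
  have h : ContinuousOn (fun y => modPhase y * (∫ s in (0:ℝ)..y, g s)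
      - rsCoeff (primitiveJet g g').modulate * rsF y) (Icc 0 1) :=
    (continuous_modPhase.continuousOn.mul (continuousOn_primitive_unit hgc)).sub
      (continuousOn_const.mul continuous_rsF.continuousOn)
  exact h.congr fun y _ => rsReduce_f_apply g g' y

/-- **Sup-norm stability of `R₁`**: if `‖G − g‖ ≤ d` on `[0,1]` then `‖R₁(G) − R₁(g)‖ ≤ 3d` on
`[0,1]` (`R₁ = E·S − t·R*` with `S = ∫₀ g`, `t = −E(1)(g(1) + (3πi/2)S(1))/(2π)`, `|E| = 1`,
`|R*| ≤ 2`, `π ≥ 2`). [folklore] -/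
theorem norm_rsReduce_f_sub_le {G : ℝ → ℂ} (G' g' : ℝ → ℂ) (hGc : ContinuousOn G (Icc 0 1))
    (hgc : ContinuousOn g (Icc 0 1)) {d : ℝ} (hd : ∀ y ∈ Icc (0:ℝ) 1, ‖G y - g y‖ ≤ d)
    {y : ℝ} (hy : y ∈ Icc (0:ℝ) 1) :
    ‖(rsReduce (primitiveJet G G').modulate).f y - (rsReduce (primitiveJet g g').modulate).f y‖
      ≤ 3 * d := by
  have h0 : (0:ℝ) ∈ Icc (0:ℝ) 1 := left_mem_Icc.2 zero_le_one
  have h1 : (1:ℝ) ∈ Icc (0:ℝ) 1 := right_mem_Icc.2 zero_le_one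
  have hd0 : 0 ≤ d := (norm_nonneg _).trans (hd 0 h0)
  have hGi : IntervalIntegrable G volume 0 1 := hGc.intervalIntegrable_of_Icc zero_le_one
  have hgi : IntervalIntegrable g volume 0 1 := hgc.intervalIntegrable_of_Icc zero_le_one
  -- the primitives differ by at most `d`
  have hS : ∀ x ∈ Icc (0:ℝ) 1, ‖(∫ s in (0:ℝ)..x, G s) - ∫ s in (0:ℝ)..x, g s‖ ≤ d := by
    intro x hx
    rw [← intervalIntegral.integral_sub (intervalIntegrable_mono_unit hGi hx)
      (intervalIntegrable_mono_unit hgi hx)]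
    exact norm_integral_le_of_le_unit hd0 hd hx
  -- the reduction coefficients differ by at most `(1/(2π) + 3/4) d`
  have hπ : (0:ℝ) < π := Real.pi_pos
  have hπ2 : (2:ℝ) ≤ π := Real.two_le_pi
  have ht : ‖rsCoeff (primitiveJet G G').modulate - rsCoeff (primitiveJet g g').modulate‖
      ≤ (1 / (2 * π) + 3 / 4) * d := by
    rw [rsCoeff_modulate_primitiveJet, rsCoeff_modulate_primitiveJet]
    have e : -(modPhase 1 * (G 1 + Complex.I * modFreq * ∫ s in (0:ℝ)..1, G s)) / (2 * π)
        - -(modPhase 1 * (g 1 + Complex.I * modFreq * ∫ s in (0:ℝ)..1, g s)) / (2 * π)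
        = -(modPhase 1 * ((G 1 - g 1) + Complex.I * modFreq *
            ((∫ s in (0:ℝ)..1, G s) - ∫ s in (0:ℝ)..1, g s))) / (2 * π) := by ring
    rw [e, norm_div, norm_neg, norm_mul, norm_modPhase, one_mul]
    have hden : ‖(2 * π : ℂ)‖ = 2 * π := by
      rw [show (2 * π : ℂ) = ((2 * π : ℝ) : ℂ) by push_cast; ring, Complex.norm_real,
        Real.norm_of_nonneg (by positivity)]
    rw [hden, div_le_iff₀ (by positivity)]
    have hnum : ‖(G 1 - g 1) + Complex.I * modFreq * ((∫ s in (0:ℝ)..1, G s) - ∫ s in (0:ℝ)..1, g s)‖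
        ≤ d + 3 * π / 2 * d := by
      refine (norm_add_le _ _).trans (add_le_add (hd 1 h1) ?_)
      rw [norm_mul, norm_mul, Complex.norm_I, one_mul, modFreq, Complex.norm_real,
        Real.norm_of_nonneg (by positivity)]
      exact mul_le_mul_of_nonneg_left (hS 1 h1) (by positivity)
    calc _ ≤ d + 3 * π / 2 * d := hnum
      _ = (1 / (2 * π) + 3 / 4) * d * (2 * π) := by field_simp; ring
  -- assemble
  rw [rsReduce_f_apply, rsReduce_f_apply]
  have e : modPhase y * (∫ s in (0:ℝ)..y, G s) - rsCoeff (primitiveJet G G').modulate * rsF y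
      - (modPhase y * (∫ s in (0:ℝ)..y, g s) - rsCoeff (primitiveJet g g').modulate * rsF y)
      = modPhase y * ((∫ s in (0:ℝ)..y, G s) - ∫ s in (0:ℝ)..y, g s)
        - (rsCoeff (primitiveJet G G').modulate - rsCoeff (primitiveJet g g').modulate) * rsF y := by
    ring
  rw [e]
  refine (norm_sub_le _ _).trans ?_
  rw [norm_mul, norm_mul, norm_modPhase, one_mul]
  have hA := hS y hy
  have hB : ‖rsCoeff (primitiveJet G G').modulate - rsCoeff (primitiveJet g g').modulate‖ * ‖rsF y‖
      ≤ (1 / (2 * π) + 3 / 4) * d * 2 :=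
    mul_le_mul ht (norm_rsF_le y) (norm_nonneg _) (by positivity)
  have hC : (1 / (2 * π) + 3 / 4) * d * 2 ≤ 2 * d := by
    have : 1 / (2 * π) ≤ 1 / 4 := by
      rw [div_le_div_iff₀ (by positivity) (by norm_num)]; linarith
    nlinarith
  linarith

/-- **Convergence of the quarter-wave coefficients of `R₁`** under uniform convergence of the
profiles on `[0,1]`. [folklore] -/
theorem tendsto_qwCoeff_rsReduce {G h : ℕ → ℝ → ℂ} {d : ℕ → ℝ}
    (hGc : ∀ n, ContinuousOn (G n) (Icc 0 1)) (hgc : ContinuousOn g (Icc 0 1))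
    (hGg : ∀ n, ∀ y ∈ Icc (0:ℝ) 1, ‖G n y - g y‖ ≤ d n) (hd : Tendsto d atTop (𝓝 0)) (k : ℕ) :
    Tendsto (fun n => qwCoeff (rsReduce (primitiveJet (G n) (h n)).modulate).f k) atTop
      (𝓝 (qwCoeff (rsReduce (primitiveJet g g').modulate).f k)) := by
  simp only [qwCoeff]
  refine tendsto_intervalIntegral_of_norm_sub_le
    (fun n => intervalIntegrable_mul_qwSin (continuousOn_rsReduce_f (hGc n)) k)
    (intervalIntegrable_mul_qwSin (continuousOn_rsReduce_f hgc) k)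
    (α := fun n => 3 * d n * √2) (fun n => ?_) ?_
  · have hpt : ∀ x ∈ Icc (0:ℝ) 1,
        ‖(rsReduce (primitiveJet (G n) (h n)).modulate).f x * ((qwSin k x : ℝ) : ℂ)
          - (rsReduce (primitiveJet g g').modulate).f x * ((qwSin k x : ℝ) : ℂ)‖ ≤ 3 * d n * √2 := by
      intro x hx
      rw [← sub_mul, norm_mul, Complex.norm_real, Real.norm_eq_abs]
      have hs : |qwSin k x| ≤ √2 := by
        rw [qwSin, abs_mul, abs_of_nonneg (Real.sqrt_nonneg _)]
        exact mul_le_of_le_one_right (Real.sqrt_nonneg _) (Real.abs_sin_le_one _)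
      have h3 : 0 ≤ 3 * d n :=
        le_trans (norm_nonneg _) (norm_rsReduce_f_sub_le (h n) g' (hGc n) hgc (hGg n) hx)
      exact mul_le_mul (norm_rsReduce_f_sub_le (h n) g' (hGc n) hgc (hGg n) hx) hs (abs_nonneg _) h3
    have i1 : IntervalIntegrable (fun x =>
        (rsReduce (primitiveJet (G n) (h n)).modulate).f x * ((qwSin k x : ℝ) : ℂ)
          - (rsReduce (primitiveJet g g').modulate).f x * ((qwSin k x : ℝ) : ℂ)) volume 0 1 :=
      (intervalIntegrable_mul_qwSin (continuousOn_rsReduce_f (hGc n)) k).sub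
        (intervalIntegrable_mul_qwSin (continuousOn_rsReduce_f hgc) k)
    calc _ ≤ ∫ x in (0:ℝ)..1, (3 * d n * √2) :=
          intervalIntegral.integral_mono_on zero_le_one i1.norm intervalIntegrable_const hpt
      _ = 3 * d n * √2 := by simp
  · have : Tendsto (fun n => 3 * d n * √2) atTop (𝓝 (3 * 0 * √2)) :=
      (hd.const_mul 3).mul_const _
    simpa using this

/-! ### `C¹` approximation of an `H¹` profile with convergence of `𝔅` -/

/-- **Density with convergence of the form** (the argument of
`MainTermFormH1.mainTermForm_nonneg_of_isH1`, repackaged): an `H¹` profile `g` is the uniform limit on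
`[0,1]` of `C¹` profiles `Gₙ` with `Gₙ(0) = g(0)` and `𝔅(Gₙ,Gₙ) → 𝔅(g,g)`. [folklore] -/
theorem IsH1OnUnitInterval.exists_c1_approx (hg : IsH1OnUnitInterval g g') :
    ∃ (G h : ℕ → ℝ → ℂ) (d : ℕ → ℝ), (∀ n, IsC1OnUnitInterval (G n) (h n)) ∧ (∀ n, G n 0 = g 0) ∧
      (∀ n, ∀ y ∈ Icc (0:ℝ) 1, ‖G n y - g y‖ ≤ d n) ∧ Tendsto d atTop (𝓝 0) ∧
      Tendsto (fun n => mainTermForm (G n) (h n)) atTop (𝓝 (mainTermForm g g')) := by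
  have h0 : (0:ℝ) ∈ Icc (0:ℝ) 1 := left_mem_Icc.2 zero_le_one
  have h1 : (1:ℝ) ∈ Icc (0:ℝ) 1 := right_mem_Icc.2 zero_le_one
  -- data about `g`
  have hgc : ContinuousOn g (Icc 0 1) := hg.continuousOn
  have hgi : IntervalIntegrable g volume 0 1 := hgc.intervalIntegrable_of_Icc zero_le_one
  have hg'i : IntervalIntegrable g' volume 0 1 := hg.intervalIntegrable
  obtain ⟨B₀, hB₀⟩ := isCompact_Icc.exists_bound_of_continuousOn hgc
  have hB : ∀ x ∈ Icc (0:ℝ) 1, ‖g x‖ ≤ max B₀ 0 := fun x hx => (hB₀ x hx).trans (le_max_left _ _)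
  have hB0 : 0 ≤ max B₀ 0 := le_max_right _ _
  -- the approximants `hₙ → g′` in `L²`
  have hex : ∀ n : ℕ, ∃ h : ℝ → ℂ, Continuous h ∧ MemLp h 2 (volume.restrict (Ioc (0:ℝ) 1)) ∧
      ∫ x in (0:ℝ)..1, ‖h x - g' x‖ ^ 2 ≤ 1 / ((n:ℝ) + 1) :=
    fun n => hg.exists_continuous_approx (by positivity)
  choose h hc hm he using hex
  obtain ⟨e, he_def⟩ : ∃ e : ℕ → ℝ, ∀ n, e n = ∫ x in (0:ℝ)..1, ‖h n x - g' x‖ ^ 2 :=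
    ⟨_, fun _ => rfl⟩
  obtain ⟨d, hd_def⟩ : ∃ d : ℕ → ℝ, ∀ n, d n = ∫ x in (0:ℝ)..1, ‖h n x - g' x‖ :=
    ⟨_, fun _ => rfl⟩
  have hhi : ∀ n, IntervalIntegrable (h n) volume 0 1 := fun n => (hc n).intervalIntegrable 0 1
  have hdi : ∀ n, IntervalIntegrable (fun x => h n x - g' x) volume 0 1 := fun n => (hhi n).sub hg'i
  have hei : ∀ n, IntervalIntegrable (fun x => ‖h n x - g' x‖ ^ 2) volume 0 1 := by
    intro n
    rw [intervalIntegrable_iff, uIoc_of_le zero_le_one]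
    have hm2 : MemLp (fun x => h n x - g' x) 2 (volume.restrict (Ioc (0:ℝ) 1)) :=
      (hm n).sub hg.memLp
    exact (memLp_two_iff_integrable_sq_norm hm2.1).1 hm2
  have he0 : ∀ n, 0 ≤ e n := fun n => by
    rw [he_def]; exact intervalIntegral.integral_nonneg zero_le_one fun x _ => sq_nonneg _
  have hd0 : ∀ n, 0 ≤ d n := fun n => by
    rw [hd_def]; exact intervalIntegral.integral_nonneg zero_le_one fun x _ => norm_nonneg _
  have he_t : Tendsto e atTop (𝓝 0) :=
    squeeze_zero he0 (fun n => (he_def n).le.trans (he n)) tendsto_one_div_add_atTop_nhds_zero_nat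
  have hsqrt_t : Tendsto (fun n => Real.sqrt (e n)) atTop (𝓝 0) := by
    have := (Real.continuous_sqrt.tendsto 0).comp he_t
    rw [Real.sqrt_zero] at this
    exact this
  have hd_le : ∀ n, d n ≤ Real.sqrt (e n) := fun n => by
    rw [Real.le_sqrt (hd0 n) (he0 n), hd_def, he_def]
    exact sq_integral_norm_le_unit (hdi n) (hei n)
  have hd_t : Tendsto d atTop (𝓝 0) := squeeze_zero hd0 hd_le hsqrt_t
  -- the `C¹` approximants `Gₙ = g(0) + ∫₀ hₙ → g` uniformly
  obtain ⟨G, hG_def⟩ : ∃ G : ℕ → ℝ → ℂ, ∀ n, G n = fun y => g 0 + ∫ t in (0:ℝ)..y, h n t :=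
    ⟨_, fun _ => rfl⟩
  have hGC1 : ∀ n, IsC1OnUnitInterval (G n) (h n) := fun n => by
    rw [hG_def]; exact isC1_const_add_primitive (hc n) (g 0)
  have hGc : ∀ n, ContinuousOn (G n) (Icc 0 1) := fun n => (hGC1 n).cont
  have hGi : ∀ n, IntervalIntegrable (G n) volume 0 1 :=
    fun n => (hGc n).intervalIntegrable_of_Icc zero_le_one
  have hG0 : ∀ n, G n 0 = g 0 := fun n => by simp [hG_def]
  have hGg : ∀ n, ∀ y ∈ Icc (0:ℝ) 1, ‖G n y - g y‖ ≤ d n := fun n y hy => by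
    rw [hG_def, hd_def]; exact norm_primitive_sub_le hg (hc n) hy
  have hGg1 : ∀ n, ∫ x in (0:ℝ)..1, ‖G n x - g x‖ ≤ d n := fun n => by
    calc ∫ x in (0:ℝ)..1, ‖G n x - g x‖ ≤ ∫ x in (0:ℝ)..1, d n :=
          intervalIntegral.integral_mono_on zero_le_one ((hGi n).sub hgi).norm
            intervalIntegrable_const (hGg n)
      _ = d n := by simp
  -- the primitives `Sₙ = ∫₀ Gₙ → S = ∫₀ g` uniformly
  have hSc : ContinuousOn (fun x => ∫ t in (0:ℝ)..x, g t) (Icc 0 1) := continuousOn_primitive_unit hgc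
  have hSnc : ∀ n, ContinuousOn (fun x => ∫ t in (0:ℝ)..x, G n t) (Icc 0 1) :=
    fun n => continuousOn_primitive_unit (hGc n)
  have hSB : ∀ x ∈ Icc (0:ℝ) 1, ‖∫ t in (0:ℝ)..x, g t‖ ≤ max B₀ 0 :=
    fun x hx => norm_integral_le_of_le_unit hB0 hB hx
  have hSnS : ∀ n, ∀ x ∈ Icc (0:ℝ) 1,
      ‖(∫ t in (0:ℝ)..x, G n t) - ∫ t in (0:ℝ)..x, g t‖ ≤ d n := fun n x hx => by
    rw [← intervalIntegral.integral_sub (intervalIntegrable_mono_unit (hGi n) hx)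
      (intervalIntegrable_mono_unit hgi hx)]
    exact norm_integral_le_of_le_unit (hd0 n) (hGg n) hx
  -- the six limits
  have L1 : Tendsto (fun n => ∫ x in (0:ℝ)..1, ‖h n x‖ ^ 2) atTop
      (𝓝 (∫ x in (0:ℝ)..1, ‖g' x‖ ^ 2)) := by
    have hN0 : 0 ≤ ∫ x in (0:ℝ)..1, ‖g' x‖ ^ 2 :=
      intervalIntegral.integral_nonneg zero_le_one fun x _ => sq_nonneg _
    obtain ⟨t, ht_def⟩ : ∃ t : ℕ → ℝ, ∀ n, t n = Real.sqrt (e n) + 1 / ((n:ℝ) + 1) :=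
      ⟨_, fun _ => rfl⟩
    have ht0 : ∀ n, 0 < t n := fun n => by
      rw [ht_def]; exact add_pos_of_nonneg_of_pos (Real.sqrt_nonneg _) (by positivity)
    have ht_t : Tendsto t atTop (𝓝 0) := by
      have := hsqrt_t.add (tendsto_one_div_add_atTop_nhds_zero_nat (𝕜 := ℝ))
      rw [add_zero] at this
      exact this.congr fun n => (ht_def n).symm
    have hh2i : ∀ n, IntervalIntegrable (fun x => ‖h n x‖ ^ 2) volume 0 1 :=
      fun n => ((hc n).norm.pow 2).intervalIntegrable 0 1
    have hbd : Tendsto (fun n => e n + Real.sqrt (e n) + t n * ∫ x in (0:ℝ)..1, ‖g' x‖ ^ 2)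
        atTop (𝓝 0) := by
      simpa using (he_t.add hsqrt_t).add (ht_t.mul (tendsto_const_nhds
        (x := ∫ x in (0:ℝ)..1, ‖g' x‖ ^ 2)))
    rw [tendsto_iff_norm_sub_tendsto_zero]
    refine squeeze_zero (fun n => norm_nonneg _) (fun n => ?_) hbd
    rw [← intervalIntegral.integral_sub (hh2i n) hg.intervalIntegrable_sq]
    have hpt : ∀ x ∈ Icc (0:ℝ) 1, ‖‖h n x‖ ^ 2 - ‖g' x‖ ^ 2‖
        ≤ (1 + 1 / t n) * ‖h n x - g' x‖ ^ 2 + t n * ‖g' x‖ ^ 2 := by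
      intro x _
      have hab : |‖h n x‖ - ‖g' x‖| ≤ ‖h n x - g' x‖ := abs_norm_sub_norm_le _ _
      have hs : ‖h n x‖ ≤ ‖h n x - g' x‖ + ‖g' x‖ := by
        calc ‖h n x‖ = ‖(h n x - g' x) + g' x‖ := by rw [sub_add_cancel]
          _ ≤ ‖h n x - g' x‖ + ‖g' x‖ := norm_add_le _ _
      have key : |‖h n x‖ ^ 2 - ‖g' x‖ ^ 2|
          ≤ ‖h n x - g' x‖ ^ 2 + 2 * (‖h n x - g' x‖ * ‖g' x‖) := by
        rw [sq_sub_sq, abs_mul, abs_of_nonneg (by positivity : 0 ≤ ‖h n x‖ + ‖g' x‖)]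
        calc (‖h n x‖ + ‖g' x‖) * |‖h n x‖ - ‖g' x‖|
            ≤ (‖h n x - g' x‖ + 2 * ‖g' x‖) * ‖h n x - g' x‖ :=
              mul_le_mul (by linarith) hab (abs_nonneg _) (by positivity)
          _ = _ := by ring
      have amgm : 2 * (‖h n x - g' x‖ * ‖g' x‖)
          ≤ ‖h n x - g' x‖ ^ 2 / t n + t n * ‖g' x‖ ^ 2 := by
        have ht := ht0 n
        rw [div_add' _ _ _ ht.ne', le_div_iff₀ ht]
        nlinarith [sq_nonneg (‖h n x - g' x‖ - t n * ‖g' x‖)]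
      rw [Real.norm_eq_abs]
      calc _ ≤ _ := key
        _ ≤ ‖h n x - g' x‖ ^ 2 + (‖h n x - g' x‖ ^ 2 / t n + t n * ‖g' x‖ ^ 2) := by linarith
        _ = (1 + 1 / t n) * ‖h n x - g' x‖ ^ 2 + t n * ‖g' x‖ ^ 2 := by ring
    have i1 : IntervalIntegrable
        (fun x => (1 + 1 / t n) * ‖h n x - g' x‖ ^ 2 + t n * ‖g' x‖ ^ 2) volume 0 1 :=
      ((hei n).const_mul _).add (hg.intervalIntegrable_sq.const_mul _)
    calc ‖∫ x in (0:ℝ)..1, (‖h n x‖ ^ 2 - ‖g' x‖ ^ 2)‖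
        ≤ ∫ x in (0:ℝ)..1, ((1 + 1 / t n) * ‖h n x - g' x‖ ^ 2 + t n * ‖g' x‖ ^ 2) :=
          intervalIntegral.norm_integral_le_of_norm_le zero_le_one
            (ae_of_all _ fun x hx => hpt x (Ioc_subset_Icc_self hx)) i1
      _ = (1 + 1 / t n) * e n + t n * ∫ x in (0:ℝ)..1, ‖g' x‖ ^ 2 := by
          rw [intervalIntegral.integral_add ((hei n).const_mul _)
              (hg.intervalIntegrable_sq.const_mul _),
            intervalIntegral.integral_const_mul, intervalIntegral.integral_const_mul, he_def]
      _ ≤ e n + Real.sqrt (e n) + t n * ∫ x in (0:ℝ)..1, ‖g' x‖ ^ 2 := by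
          have hq : 1 / t n * e n ≤ Real.sqrt (e n) := by
            rw [one_div, inv_mul_le_iff₀ (ht0 n)]
            calc e n = Real.sqrt (e n) * Real.sqrt (e n) := (Real.mul_self_sqrt (he0 n)).symm
              _ ≤ t n * Real.sqrt (e n) := by
                  refine mul_le_mul_of_nonneg_right ?_ (Real.sqrt_nonneg _)
                  rw [ht_def]; exact le_add_of_nonneg_right (by positivity)
          nlinarith [hq]
  have L2 : Tendsto (fun n => ∫ x in (0:ℝ)..1, h n x * conj (G n x)) atTop
      (𝓝 (∫ x in (0:ℝ)..1, g' x * conj (g x))) :=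
    tendsto_intervalIntegral_mul_conj hhi hg'i hGc hgc (fun n => (hd_def n).symm.le) hd_t
      hGg hd_t hB
  have L3 : Tendsto (fun n => ∫ x in (0:ℝ)..1, ‖G n x‖ ^ 2) atTop
      (𝓝 (∫ x in (0:ℝ)..1, ‖g x‖ ^ 2)) := by
    have L3c := tendsto_intervalIntegral_mul_conj hGi hgi hGc hgc hGg1 hd_t hGg hd_t hB
    have := (Complex.continuous_re.tendsto _).comp L3c
    simpa [Function.comp_def, integral_mul_conj_eq_ofReal] using this
  have L4 : Tendsto (fun n => ∫ x in (0:ℝ)..1, G n x * conj (∫ t in (0:ℝ)..x, G n t)) atTop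
      (𝓝 (∫ x in (0:ℝ)..1, g x * conj (∫ t in (0:ℝ)..x, g t))) :=
    tendsto_intervalIntegral_mul_conj hGi hgi hSnc hSc hGg1 hd_t hSnS hd_t hSB
  have L5 : Tendsto (fun n => ∫ x in (0:ℝ)..1, G n x) atTop (𝓝 (∫ x in (0:ℝ)..1, g x)) :=
    tendsto_intervalIntegral_of_norm_sub_le hGi hgi hGg1 hd_t
  have L6 : Tendsto (fun n => G n 1) atTop (𝓝 (g 1)) := by
    rw [tendsto_iff_norm_sub_tendsto_zero]
    exact squeeze_zero (fun n => norm_nonneg _) (fun n => hGg n 1 h1) hd_t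
  -- assembly
  have hlim : Tendsto (fun n => mainTermForm (G n) (h n)) atTop (𝓝 (mainTermForm g g')) := by
    simp only [mainTermForm_eq, hG0]
    refine Tendsto.add (Tendsto.sub (Tendsto.add (Tendsto.add (Tendsto.add ?_ ?_) ?_) ?_) ?_) ?_
    · exact L1.const_mul _
    · exact ((Complex.continuous_im.tendsto _).comp L2).const_mul _
    · exact L3.const_mul _
    · exact ((Complex.continuous_im.tendsto _).comp L4).const_mul _
    · exact ((Complex.continuous_re.tendsto _).comp
        (((Complex.continuous_conj.tendsto _).comp L5).mul (tendsto_const_nhds.add L6))).const_mul _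
    · exact ((Complex.continuous_im.tendsto _).comp
        (tendsto_const_nhds.mul ((Complex.continuous_conj.tendsto _).comp L6))).const_mul _
  exact ⟨G, h, d, hGC1, hG0, hGg, hd_t, hlim⟩

/-! ### Bessel form of the sum-of-squares identity on `H¹` -/

/-- **Bessel inequality for `𝔅` on `H¹`**: every finite partial sum of
`(8/π) ∑ₖ π⁴(k−1)k(k+1)(k+2)|c_k(R₁)|²` is at most `𝔅(g,g)` (for `C¹` profiles the full series
EQUALS `𝔅(g,g)`, `MainTermFormPSD.mainTermForm_hasSum`; here the finite sums for the `C¹`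
approximants pass to the limit). [folklore] -/
theorem sum_range_le_mainTermForm_of_isH1 (hg : IsH1OnUnitInterval g g') (N : ℕ) :
    ∑ k ∈ Finset.range N,
        8 / π * (dnWeight k * ‖qwCoeff (rsReduce (primitiveJet g g').modulate).f k‖ ^ 2)
      ≤ mainTermForm g g' := by
  obtain ⟨G, h, d, hGC1, -, hGg, hd_t, hlim⟩ := hg.exists_c1_approx
  have hGc : ∀ n, ContinuousOn (G n) (Icc 0 1) := fun n => (hGC1 n).cont
  have hsum : Tendsto (fun n => ∑ k ∈ Finset.range N,
      8 / π * (dnWeight k * ‖qwCoeff (rsReduce (primitiveJet (G n) (h n)).modulate).f k‖ ^ 2))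
      atTop (𝓝 (∑ k ∈ Finset.range N,
        8 / π * (dnWeight k * ‖qwCoeff (rsReduce (primitiveJet g g').modulate).f k‖ ^ 2))) := by
    refine tendsto_finsetSum _ fun k _ => ?_
    exact (((tendsto_qwCoeff_rsReduce hGc hg.continuousOn hGg hd_t k).norm.pow 2).const_mul
      _).const_mul _
  refine le_of_tendsto_of_tendsto' hsum hlim fun n => ?_
  exact sum_le_hasSum (Finset.range N)
    (fun k _ => mul_nonneg (div_nonneg (by norm_num) Real.pi_pos.le)
      (mul_nonneg (dnWeight_nonneg k) (sq_nonneg _)))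
    (mainTermForm_hasSum (hGC1 n))

/-- The coefficient series of an `H¹` profile is summable. [folklore] -/
theorem summable_coeffTerm_of_isH1 (hg : IsH1OnUnitInterval g g') :
    Summable fun k : ℕ =>
      8 / π * (dnWeight k * ‖qwCoeff (rsReduce (primitiveJet g g').modulate).f k‖ ^ 2) :=
  summable_of_sum_range_le
    (fun k => mul_nonneg (div_nonneg (by norm_num) Real.pi_pos.le)
      (mul_nonneg (dnWeight_nonneg k) (sq_nonneg _)))
    (sum_range_le_mainTermForm_of_isH1 hg)

/-- **`(8/π) ∑ₖ π⁴(k−1)k(k+1)(k+2)|c_k(R₁)|² ≤ 𝔅(g,g)`** for every `H¹` profile. [folklore] -/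
theorem tsum_le_mainTermForm_of_isH1 (hg : IsH1OnUnitInterval g g') :
    ∑' k : ℕ, 8 / π * (dnWeight k * ‖qwCoeff (rsReduce (primitiveJet g g').modulate).f k‖ ^ 2)
      ≤ mainTermForm g g' :=
  Real.tsum_le_of_sum_range_le
    (fun k => mul_nonneg (div_nonneg (by norm_num) Real.pi_pos.le)
      (mul_nonneg (dnWeight_nonneg k) (sq_nonneg _)))
    (sum_range_le_mainTermForm_of_isH1 hg)

/-- Each single mode is controlled by the form: `(8/π)·π⁴(k−1)k(k+1)(k+2)|c_k(R₁)|² ≤ 𝔅(g,g)`.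
[folklore] -/
theorem coeffTerm_le_mainTermForm_of_isH1 (hg : IsH1OnUnitInterval g g') (k : ℕ) :
    8 / π * (dnWeight k * ‖qwCoeff (rsReduce (primitiveJet g g').modulate).f k‖ ^ 2)
      ≤ mainTermForm g g' := by
  refine le_trans ?_ (sum_range_le_mainTermForm_of_isH1 hg (k + 1))
  exact Finset.single_le_sum (f := fun k =>
      8 / π * (dnWeight k * ‖qwCoeff (rsReduce (primitiveJet g g').modulate).f k‖ ^ 2))
    (fun j _ => mul_nonneg (div_nonneg (by norm_num) Real.pi_pos.le)
      (mul_nonneg (dnWeight_nonneg j) (sq_nonneg _)))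
    (Finset.self_mem_range_succ k)

/-- **Kernel ⇒ coefficients, on `H¹`**: if `𝔅(g,g) = 0` for an `H¹` profile then every quarter-wave
coefficient `c_k(R₁)`, `k ≥ 2`, of its reduced modulated primitive vanishes. [folklore] -/
theorem qwCoeff_rsReduce_eq_zero_of_isH1 (hg : IsH1OnUnitInterval g g') (h0 : mainTermForm g g' = 0)
    {k : ℕ} (hk : 2 ≤ k) : qwCoeff (rsReduce (primitiveJet g g').modulate).f k = 0 := by
  have h := coeffTerm_le_mainTermForm_of_isH1 hg k
  rw [h0] at h
  have hπ : 0 < 8 / π := div_pos (by norm_num) Real.pi_pos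
  have hw : 0 < dnWeight k := dnWeight_pos k hk
  have hsq : ‖qwCoeff (rsReduce (primitiveJet g g').modulate).f k‖ ^ 2 ≤ 0 := by
    by_contra hcon
    push Not at hcon
    have : 0 < 8 / π * (dnWeight k * ‖qwCoeff (rsReduce (primitiveJet g g').modulate).f k‖ ^ 2) :=
      mul_pos hπ (mul_pos hw hcon)
    linarith
  have : ‖qwCoeff (rsReduce (primitiveJet g g').modulate).f k‖ = 0 := by
    nlinarith [norm_nonneg (qwCoeff (rsReduce (primitiveJet g g').modulate).f k)]
  exact norm_eq_zero.mp this

/-! ### From vanishing coefficients to the span, for continuous profiles -/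

/-- **Coefficients ⇒ span, continuous version** of
`MainTermFormKernel.exists_eqOn_afeSpan_of_qwCoeff_eq_zero`: its `C¹` hypothesis is used only through
the continuity of `g` on `[0,1]` (continuity of `R₁` for the completeness lemma, and `S′ = g` on
`(0,1)` for the primitive `S = ∫₀ g`). [folklore] -/
theorem exists_eqOn_afeSpan_of_qwCoeff_eq_zero_of_continuousOn (hgc : ContinuousOn g (Icc 0 1))
    (h : ∀ k, 2 ≤ k → qwCoeff (rsReduce (primitiveJet g g').modulate).f k = 0) :
    ∃ a b c : ℂ, EqOn g (fun y => a * afeDir 1 y + b * afeDir 2 y + c * afeDir 3 y) (Icc 0 1) := by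
  have hR₁ : ContinuousOn (rsReduce (primitiveJet g g').modulate).f (Icc 0 1) :=
    continuousOn_rsReduce_f hgc
  set c₀ := qwCoeff (rsReduce (primitiveJet g g').modulate).f 0 with hc₀
  set c₁ := qwCoeff (rsReduce (primitiveJet g g').modulate).f 1 with hc₁
  set t := rsCoeff (primitiveJet g g').modulate with ht
  -- Step 1: `R₁ = c₀ e₀ + c₁ e₁` on `[0,1]` (completeness).
  have h1 : EqOn (rsReduce (primitiveJet g g').modulate).f
      (fun x => c₀ * qwMode 0 x + c₁ * qwMode 1 x) (Icc 0 1) :=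
    eqOn_modes_of_qwCoeff_eq_zero hR₁ h
  -- Step 2: `S = A₀ + A₁ v² + A₂ v⁴ + A₃ v⁶` on `[0,1]`.
  set A₀ : ℂ := -(c₁ * ((√2 : ℝ) : ℂ) * Complex.I / 2) - t / 2 with hA₀
  set A₁ : ℂ := -(c₀ * ((√2 : ℝ) : ℂ) * Complex.I / 2) + t / 2 with hA₁
  set A₂ : ℂ := c₀ * ((√2 : ℝ) : ℂ) * Complex.I / 2 + t / 2 with hA₂
  set A₃ : ℂ := c₁ * ((√2 : ℝ) : ℂ) * Complex.I / 2 - t / 2 with hA₃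
  set G : ℝ → ℂ := fun y => A₀ + A₁ * afeDir 1 y + A₂ * afeDir 2 y + A₃ * afeDir 3 y with hG
  have h2 : EqOn (fun y => ∫ s in (0:ℝ)..y, g s) G (Icc 0 1) := by
    intro y hy
    have e1 := h1 hy
    rw [rsReduce_f_apply] at e1
    have hm := modPhase_mul_pow y
    have e2 : (∫ s in (0:ℝ)..y, g s) =
        halfPhase y ^ 3 * (c₀ * qwMode 0 y + c₁ * qwMode 1 y + t * rsF y) := by
      linear_combination (halfPhase y ^ 3) * e1 - (∫ s in (0:ℝ)..y, g s) * hm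
    simp only [hG]
    rw [e2, qwMode_zero_eq, qwMode_one_eq, rsF_eq, afeDir_eq_pow, afeDir_eq_pow, afeDir_eq_pow]
    have hv := halfPhase_ne_zero y
    field_simp
    ring
  -- Step 3: `g = S′ = G′` on `(0,1)`, extended to `[0,1]` by continuity.
  have hGd : ∀ y, HasDerivAt G (A₁ * afeDir' 1 y + A₂ * afeDir' 2 y + A₃ * afeDir' 3 y) y := by
    intro y
    exact ((((hasDerivAt_afeDir 1 y).const_mul A₁).const_add A₀).add
      ((hasDerivAt_afeDir 2 y).const_mul A₂)).add ((hasDerivAt_afeDir 3 y).const_mul A₃)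
  have h3 : EqOn g (fun y => A₁ * afeDir' 1 y + A₂ * afeDir' 2 y + A₃ * afeDir' 3 y) (Icc 0 1) := by
    have hIoo : EqOn g (fun y => A₁ * afeDir' 1 y + A₂ * afeDir' 2 y + A₃ * afeDir' 3 y)
        (Ioo 0 1) := by
      intro x hx
      have hint : IntervalIntegrable g volume 0 x :=
        (hgc.mono (Icc_subset_Icc_right hx.2.le)).intervalIntegrable_of_Icc hx.1.le
      have hmeas : StronglyMeasurableAtFilter g (nhds x) volume :=
        ContinuousOn.stronglyMeasurableAtFilter isOpen_Ioo (hgc.mono Ioo_subset_Icc_self) x hx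
      have hcont : ContinuousAt g x := hgc.continuousAt (Icc_mem_nhds hx.1 hx.2)
      have hS : HasDerivAt (fun y => ∫ s in (0:ℝ)..y, g s) (g x) x :=
        intervalIntegral.integral_hasDerivAt_right hint hmeas hcont
      have hSG : G =ᶠ[nhds x] (fun y => ∫ s in (0:ℝ)..y, g s) :=
        (Filter.eventuallyEq_of_mem (Icc_mem_nhds hx.1 hx.2) h2).symm
      exact (hS.congr_of_eventuallyEq hSG).unique (hGd x)
    have hc : ContinuousOn (fun y => A₁ * afeDir' 1 y + A₂ * afeDir' 2 y + A₃ * afeDir' 3 y)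
        (Icc 0 1) := by
      apply Continuous.continuousOn
      exact ((continuous_const.mul (continuous_afeDir' 1)).add
        (continuous_const.mul (continuous_afeDir' 2))).add
        (continuous_const.mul (continuous_afeDir' 3))
    refine hIoo.of_subset_closure hgc hc Ioo_subset_Icc_self ?_
    rw [closure_Ioo zero_ne_one]
  refine ⟨A₁ * afeFreq 1, A₂ * afeFreq 2, A₃ * afeFreq 3, fun y hy => ?_⟩
  rw [h3 hy]
  simp only [afeDir']
  ring

/-! ### The marked weak derivative is the classical derivative almost everywhere -/

/-- **Uniqueness of the weak derivative a.e.**: if `g` is an `H¹` profile with marked derivative `g′`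
and `g` has a classical derivative `D(x)` at every point of `(0,1)`, then `g′ = D` almost everywhere on
`(0,1]` (Lebesgue's differentiation theorem for `y ↦ ∫₀ʸ g′ = g(y) − g(0)`). [folklore] -/
theorem IsH1OnUnitInterval.ae_eq_of_hasDerivAt (hg : IsH1OnUnitInterval g g') {D : ℝ → ℂ}
    (hD : ∀ x ∈ Ioo (0:ℝ) 1, HasDerivAt g (D x) x) :
    g' =ᵐ[volume.restrict (Ioc (0:ℝ) 1)] D := by
  have hae := hg.intervalIntegrable.ae_hasDerivAt_integral
  have h1 : ∀ᵐ x : ℝ, x ≠ 1 := by simp [ae_iff, measure_singleton]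
  rw [Filter.EventuallyEq, ae_restrict_iff' measurableSet_Ioc]
  filter_upwards [hae, h1] with x hx hx1 hxI
  have hx' : x ∈ Ioo (0:ℝ) 1 := ⟨hxI.1, lt_of_le_of_ne hxI.2 hx1⟩
  have hu : uIcc (0:ℝ) 1 = Icc 0 1 := uIcc_of_le zero_le_one
  have hP : HasDerivAt (fun y => ∫ t in (0:ℝ)..y, g' t) (g' x) x :=
    hx (by rw [hu]; exact Ioo_subset_Icc_self hx') 0 (by rw [hu]; exact left_mem_Icc.2 zero_le_one)
  have hEq : (fun y => g y - g 0) =ᶠ[𝓝 x] (fun y => ∫ t in (0:ℝ)..y, g' t) := by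
    filter_upwards [Icc_mem_nhds hx'.1 hx'.2] with y hy
    rw [hg.eq_add_integral y hy]
    ring
  have hQ : HasDerivAt (fun y => g y - g 0) (g' x) x := hP.congr_of_eventuallyEq hEq
  have hR : HasDerivAt (fun y => g y - g 0) (D x) x := (hD x hx').sub_const (g 0)
  exact hQ.unique hR

/-- **`𝔅(g,g′)` depends only on `g|[0,1]` and on `g′` a.e. on `(0,1)`.** [folklore] -/
theorem mainTermForm_congr_ae {g₁ g₁' g₂ g₂' : ℝ → ℂ} (hg : EqOn g₁ g₂ (Icc 0 1))
    (hg' : g₁' =ᵐ[volume.restrict (Ioc (0:ℝ) 1)] g₂') :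
    mainTermForm g₁ g₁' = mainTermForm g₂ g₂' := by
  have h0 : (0:ℝ) ∈ Icc (0:ℝ) 1 := left_mem_Icc.2 zero_le_one
  have h1 : (1:ℝ) ∈ Icc (0:ℝ) 1 := right_mem_Icc.2 zero_le_one
  have hu : uIcc (0:ℝ) 1 = Icc 0 1 := uIcc_of_le zero_le_one
  have hae : ∀ᵐ x : ℝ, x ∈ uIoc (0:ℝ) 1 → g₁' x = g₂' x := by
    rw [uIoc_of_le zero_le_one]
    exact (ae_restrict_iff' measurableSet_Ioc).1 hg'
  have hS : ∀ x ∈ Icc (0:ℝ) 1, ∫ t in (0:ℝ)..x, g₁ t = ∫ t in (0:ℝ)..x, g₂ t := by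
    intro x hx
    refine intervalIntegral.integral_congr fun t ht => ?_
    rw [uIcc_of_le hx.1] at ht
    exact hg ⟨ht.1, ht.2.trans hx.2⟩
  have e1 : ∫ x in (0:ℝ)..1, ‖g₁' x‖ ^ 2 = ∫ x in (0:ℝ)..1, ‖g₂' x‖ ^ 2 := by
    refine intervalIntegral.integral_congr_ae ?_
    filter_upwards [hae] with x hx hxm
    rw [hx hxm]
  have e2 : ∫ x in (0:ℝ)..1, g₁' x * conj (g₁ x) = ∫ x in (0:ℝ)..1, g₂' x * conj (g₂ x) := by
    refine intervalIntegral.integral_congr_ae ?_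
    filter_upwards [hae] with x hx hxm
    have hxI : x ∈ Icc (0:ℝ) 1 := by
      rw [uIoc_of_le zero_le_one] at hxm; exact Ioc_subset_Icc_self hxm
    rw [hx hxm, hg hxI]
  have e3 : ∫ x in (0:ℝ)..1, ‖g₁ x‖ ^ 2 = ∫ x in (0:ℝ)..1, ‖g₂ x‖ ^ 2 :=
    intervalIntegral.integral_congr fun x hx => by rw [hg (hu ▸ hx)]
  have e4 : ∫ x in (0:ℝ)..1, g₁ x * conj (∫ t in (0:ℝ)..x, g₁ t) =
      ∫ x in (0:ℝ)..1, g₂ x * conj (∫ t in (0:ℝ)..x, g₂ t) :=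
    intervalIntegral.integral_congr fun x hx => by rw [hg (hu ▸ hx), hS x (hu ▸ hx)]
  rw [mainTermForm_eq, mainTermForm_eq, e1, e2, e3, e4, hS 1 h1, hg h0, hg h1]

/-! ### The kernel of `𝔅` on `H¹` profiles -/

/-- **O15 on `H¹`, kernel — the kernel of `𝔅` on `H¹` profiles is exactly the span of the three
approximate-functional-equation directions.** For every `H¹` profile `g` with marked weak derivative
`g′` (in particular every continuous piecewise-`C¹`, kinked, profile):
`𝔅(g,g) = 0 ↔ g ∈ span{e^{−iπy}, e^{−2iπy}, e^{−3iπy}}` as functions on `[0,1]`. [folklore] -/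
theorem mainTermForm_eq_zero_iff_afeSpan_of_isH1 (hg : IsH1OnUnitInterval g g') :
    mainTermForm g g' = 0 ↔
      ∃ a b c : ℂ, EqOn g (fun y => a * afeDir 1 y + b * afeDir 2 y + c * afeDir 3 y) (Icc 0 1) := by
  constructor
  · intro h0
    exact exists_eqOn_afeSpan_of_qwCoeff_eq_zero_of_continuousOn hg.continuousOn
      fun k hk => qwCoeff_rsReduce_eq_zero_of_isH1 hg h0 hk
  · rintro ⟨a, b, c, h⟩
    have hC1 := isC1_afeSpan a b c
    have hD : ∀ x ∈ Ioo (0:ℝ) 1,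
        HasDerivAt g (a * afeDir' 1 x + b * afeDir' 2 x + c * afeDir' 3 x) x := by
      intro x hx
      have hGx := hC1.hasDeriv x hx
      have hEq : g =ᶠ[𝓝 x] (fun y => a * afeDir 1 y + b * afeDir 2 y + c * afeDir 3 y) :=
        Filter.eventuallyEq_of_mem (Icc_mem_nhds hx.1 hx.2) h
      exact hGx.congr_of_eventuallyEq hEq
    rw [mainTermForm_congr_ae h (hg.ae_eq_of_hasDerivAt hD)]
    exact mainTermForm_afeSpan a b c

/-- **Coefficient form of the kernel on `H¹`**: `𝔅(g,g) = 0` iff all quarter-wave coefficients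
`c_k(R₁)`, `k ≥ 2`, of the reduced modulated primitive vanish (`MainTermFormPSD.mainTermForm_eq_zero_iff`
for `C¹` profiles). [folklore] -/
theorem mainTermForm_eq_zero_iff_of_isH1 (hg : IsH1OnUnitInterval g g') :
    mainTermForm g g' = 0 ↔
      ∀ k : ℕ, 2 ≤ k → qwCoeff (rsReduce (primitiveJet g g').modulate).f k = 0 := by
  constructor
  · exact fun h0 k hk => qwCoeff_rsReduce_eq_zero_of_isH1 hg h0 hk
  · intro h
    exact (mainTermForm_eq_zero_iff_afeSpan_of_isH1 hg).mpr
      (exists_eqOn_afeSpan_of_qwCoeff_eq_zero_of_continuousOn hg.continuousOn h)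

/-- **Strict positivity off the span, on `H¹`**: an `H¹` profile that is not a combination of the
three AFE directions on `[0,1]` has `𝔅(g,g) > 0`. [folklore] -/
theorem mainTermForm_pos_of_not_afeSpan_of_isH1 (hg : IsH1OnUnitInterval g g')
    (h : ¬ ∃ a b c : ℂ, EqOn g (fun y => a * afeDir 1 y + b * afeDir 2 y + c * afeDir 3 y)
      (Icc 0 1)) : 0 < mainTermForm g g' :=
  lt_of_le_of_ne (mainTermForm_nonneg_of_isH1 hg)
    (fun h0 => h ((mainTermForm_eq_zero_iff_afeSpan_of_isH1 hg).mp h0.symm))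

/-- **Kinked profiles**: for `g` continuous on `[0,1]`, right-differentiable at every interior point
with right derivative `g′ ∈ L²(0,1)` (the shape of the manuscript's continuous piecewise poly×exp
profiles), `𝔅(g,g) = 0 ↔ g ∈ span{e^{−iπy}, e^{−2iπy}, e^{−3iπy}}` on `[0,1]`. [folklore] -/
theorem mainTermForm_eq_zero_iff_afeSpan_of_hasDerivWithinAt_Ioi (hc : ContinuousOn g (Icc 0 1))
    (hd : ∀ x ∈ Ioo (0:ℝ) 1, HasDerivWithinAt g (g' x) (Ioi x) x)
    (hm : MemLp g' 2 (volume.restrict (Ioc (0:ℝ) 1))) :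
    mainTermForm g g' = 0 ↔
      ∃ a b c : ℂ, EqOn g (fun y => a * afeDir 1 y + b * afeDir 2 y + c * afeDir 3 y) (Icc 0 1) :=
  mainTermForm_eq_zero_iff_afeSpan_of_isH1 (isH1_of_hasDerivWithinAt_Ioi hc hd hm)

/-- **Kinked profiles with a bounded right derivative**: `𝔅(g,g) > 0` unless `g` is a combination of
the three AFE directions on `[0,1]`. [folklore] -/
theorem mainTermForm_pos_of_not_afeSpan_of_bounded_rightDeriv (hc : ContinuousOn g (Icc 0 1))
    (hd : ∀ x ∈ Ioo (0:ℝ) 1, HasDerivWithinAt g (g' x) (Ioi x) x)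
    (hmeas : AEStronglyMeasurable g' (volume.restrict (Ioc (0:ℝ) 1))) {C : ℝ}
    (hC : ∀ x ∈ Ioc (0:ℝ) 1, ‖g' x‖ ≤ C)
    (h : ¬ ∃ a b c : ℂ, EqOn g (fun y => a * afeDir 1 y + b * afeDir 2 y + c * afeDir 3 y)
      (Icc 0 1)) : 0 < mainTermForm g g' :=
  mainTermForm_pos_of_not_afeSpan_of_isH1
    (isH1_of_hasDerivWithinAt_Ioi hc hd
      (MemLp.of_bound hmeas C ((ae_restrict_iff' measurableSet_Ioc).2 (ae_of_all _ hC)))) h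

end Literature.NumberTheory.LFunctions.Zhang2022

end
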